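import Mathlib
import Summits.ResolutionOfSingularities.ResolutionOfSingularities.Theorems.WeightedInvariantLocalWeightedDropSpaceCountGame

/-!
# `WeightedInvariant.LocalWeightedDrop`, line `tame-four-tuple-drop`: GLUE (A3-α) ∘ (G3) — the tuple game in `m + 1` variables from
# finite-depth winnability of the count game, NC-heredity and a monomial phase

Crux item stmt-ResolutionOfSingularities-8899 `LocalWeightedDrop` (route `ResolutionOfSingularities/WeightedInvariant`); strategist line
`tame-four-tuple-drop` (res-L1-w43-strat-1).  [OURS · L1 W4.3, chain w43, res-type-056; kernel check that the count exported by (A3-α)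
(`count_of_winsIn`, p503527) has EXACTLY the clause shapes consumed by res-type-088's (G3) assembly `tupleDrop_of_count_of_monomialPhase`
(p501911), so that (A3-β)'s `htot` and (N1), together with (B3), give `TupleGame.Drop k (m+1) e` by a one-line composition.  Nothing here is a
statement of any manuscript.]

* `tupleDrop_of_winsIn` — general `m`, predicate `GermIsNC`: NC-heredity + finite-depth winnability + monomial phase (088's hypothesis shape) ⇒
  `∀ e, TupleGame.Drop k (m + 1) e`;
* `tupleDropThree_of_winsIn` — the literal `Fin 3` / `SpaceIsNC` instance (the N = 4 tame line's (A3)+(B3)+(G3) modulo (A3-β)'s input).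
-/

set_option linter.dupNamespace false -- mandated namespace of this single-conjunct summit

namespace Summit.ResolutionOfSingularities.ResolutionOfSingularities.Theorems

namespace TameFourTupleDrop

open MvPowerSeries Literature.AlgebraicGeometry.Resolution

variable {k : Type} [Field k]

/-- (A3-α) ∘ (G3), general `m` (OURS · L1 W4.3): NC-heredity of `GermIsNC`, finite-depth winnability of the count game for `GermIsNC`, and a
monomial phase for `GermIsNC ∘ prodSupport` give the tuple game `TupleGame.Drop k (m + 1) e` for every `e`. -/
theorem tupleDrop_of_winsIn (m : ℕ)
    (hN1 : ∀ (N : ℕ) (b d : MvPowerSeries (Fin (m + 1)) k), d ≠ 0 → GermIsNC d → b ∣ d ^ (N + 1) → GermIsNC b)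
    (htot : ∀ b : MvPowerSeries (Fin (m + 1)) k, b ≠ 0 → ∃ n, WinsIn GermIsNC n b)
    (hmono : ∀ e : ℕ, ∃ (β : Ordinal.{0}) (μ : (Fin (e + 1) → MvPowerSeries (Fin (m + 1)) k) → Ordinal.{0}),
      (∀ a, μ a < β) ∧
      ∀ a : Fin (e + 1) → MvPowerSeries (Fin (m + 1)) k, a ≠ 0 → TupleGame.Bad a →
        GermIsNC (TupleGame.prodSupport a) →
        TupleGame.StepDrop μ (fun b => GermIsNC (TupleGame.prodSupport b)) a) :
    ∀ e : ℕ, TupleGame.Drop k (m + 1) e := by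
  obtain ⟨ν, h₁, h₂, h₃⟩ := count_of_winsIn GermIsNC htot hN1
  exact tupleDrop_of_count_of_monomialPhase m GermIsNC ν h₁ h₂ h₃ hmono

/-- The three-variable instance (OURS · L1 W4.3; the N = 4 tame line's (A3) + (B3) + (G3) modulo the transfer (A3-β)): NC-heredity of
`SpaceIsNC`, finite-depth winnability for `SpaceIsNC`, and a monomial phase for `SpaceIsNC ∘ prodSupport` give `TupleGame.Drop k 3 e` for
every `e`. -/
theorem tupleDropThree_of_winsIn
    (hN1 : ∀ (N : ℕ) (b d : MvPowerSeries (Fin 3) k), d ≠ 0 → SpaceIsNC d → b ∣ d ^ (N + 1) → SpaceIsNC b)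
    (htot : ∀ b : MvPowerSeries (Fin 3) k, b ≠ 0 → ∃ n, WinsIn SpaceIsNC n b)
    (hmono : ∀ e : ℕ, ∃ (β : Ordinal.{0}) (μ : (Fin (e + 1) → MvPowerSeries (Fin 3) k) → Ordinal.{0}),
      (∀ a, μ a < β) ∧
      ∀ a : Fin (e + 1) → MvPowerSeries (Fin 3) k, a ≠ 0 → TupleGame.Bad a →
        SpaceIsNC (TupleGame.prodSupport a) →
        TupleGame.StepDrop μ (fun b => SpaceIsNC (TupleGame.prodSupport b)) a) :
    ∀ e : ℕ, TupleGame.Drop k 3 e := by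
  obtain ⟨ν, h₁, h₂, h₃⟩ := spaceGermNonNCCountRad_of_winsIn hN1 htot
  exact tupleDropThree_of_count_of_monomialPhase SpaceIsNC ν h₁ h₂ h₃ hmono

end TameFourTupleDrop

end Summit.ResolutionOfSingularities.ResolutionOfSingularities.Theorems
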